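import Summits.CriticalPhenomena.PercolationContinuityZ3.Theorems.PercNearOneGluingNoHeavyLowerTailKNGoodGMgcCertBil1
import Summits.CriticalPhenomena.PercolationContinuityZ3.Theorems.PercNearOneGluingNoHeavyLowerTailKNGoodGMgcCertBil2
import Summits.CriticalPhenomena.PercolationContinuityZ3.Theorems.PercNearOneGluingNoHeavyLowerTailKNGoodGMgcCertBil3
import Summits.CriticalPhenomena.PercolationContinuityZ3.Theorems.PercNearOneGluingNoHeavyLowerTailKNGoodGMgcCertTri1D
import Summits.CriticalPhenomena.PercolationContinuityZ3.Theorems.PercNearOneGluingNoHeavyLowerTailKNGoodGMgcCertTri1AD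
import Summits.CriticalPhenomena.PercolationContinuityZ3.Theorems.PercNearOneGluingNoHeavyLowerTailKNGoodGMgcCertTri2D
import Summits.CriticalPhenomena.PercolationContinuityZ3.Theorems.PercNearOneGluingNoHeavyLowerTailKNGoodGMgcCertTri2AD
import Summits.CriticalPhenomena.PercolationContinuityZ3.Theorems.PercNearOneGluingNoHeavyLowerTailKNGoodGMgcCertTri3D
import Summits.CriticalPhenomena.PercolationContinuityZ3.Theorems.PercNearOneGluingNoHeavyLowerTailKNGoodGMgcCertTri3AD
import HarnessLib

/-!
# THEOREM B (Kozma–Nitzan goodness with a grandchild) — the complete certificate layer: all 27 conditions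
# (`NoHeavyLowerTail` cell, stmt-CriticalPhenomena-4575; prover `prim-hp-2`, gen 17)

Support file (`--supports stmt-CriticalPhenomena-4575`).  No definitions, no named facts, no sorries; assembles the nine bilinear
(`…CertBil1-3`) and eighteen trilinear (`…CertTri*`) certificate theorems (each COMPUTATIONAL: `native_decide`) into one statement.
Setting: MEMO-gen15-grandchild-certificates.md §3 (HOME `run/shared/lean/prim/prim-hp-2/`); THEOREM-B-grandchild.md §2: for `j = argmin_K`,
`Φ(K/B, o*; j) ≥ 0` is equivalent (Fourier–Motzkin on the two loneliness multipliers, cone `𝒞₅` of the core scalars) to (B1a,b),(B2a,b),(B3a,b)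
for every pocket reference `r`; multiplied out these are exactly the 27 polynomial inequalities below on the twelve side parameters
(`x 0..8` = hairs `x₁,x₂,x₃,y₁,y₂,y₃,z₁,z₂,z₃`, `x 9` = pair `yz`, `x 10` = pair `xz`, `x 11` = pair `xy`).
What is NOT here (next generation): the percolation semantics — that `bexp 11 (fun c => phiHat j r c v) x` IS the `v`-coefficient of the
goodness target of `K/B` and `bexp 12 (qHat ws) x` IS the world law of `K`'s side under `prodBernoulli` (the (σ,S)-expansion of the
two-vertex observer side, MEMO-gen15 §6), and the Fourier–Motzkin step back to `Φ ≥ 0`.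
-/

namespace Summit.CriticalPhenomena.PercolationContinuityZ3.Theorems

namespace KNGoodGMgc

/-- **THEOREM B — certificate layer (all 27 conditions of MEMO-gen15 §3d hold on `[0,1]¹²`).**
(i) bilinear (B1a),(B2a),(B3a): `0 ≤ Φ_β(j;r)·Q₁₂ + Φ_ε(j;r)·Q_d`; (ii) trilinear (B1b),(B2b),(B3b), both branches:
`X·v·w + Y·u·w ≤ G·u·v` with the factors of `KNGoodGMgc.facX … facW`; for every designee position `j`, pocket reference `r`
in `{1,2,3}` and branch `ad`. [this work] -/
theorem theoremB_certificates (j r : ℕ) (hj : j = 1 ∨ j = 2 ∨ j = 3) (hr : r = 1 ∨ r = 2 ∨ r = 3) (ad : Bool)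
    (x : ℕ → ℝ) (hx : ∀ i, 0 ≤ x i ∧ x i ≤ 1) :
    (0 ≤ bexp 11 (fun c => phiHat j r c 1) x * bexp 12 (qHat [3]) x + bexp 11 (fun c => phiHat j r c 4) x * bexp 12 (qHat [0]) x) ∧
    (bexp 11 (facX j r ad) x * (bexp 12 (qHat (facV j)) x * bexp 12 (qHat (facW j ad)) x) +
        bexp 11 (facY j r) x * (bexp 12 (qHat (facU j ad)) x * bexp 12 (qHat (facW j ad)) x) ≤
      bexp 11 (facG j r ad) x * (bexp 12 (qHat (facU j ad)) x * bexp 12 (qHat (facV j)) x)) := by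
  rcases hj with rfl | rfl | rfl
  · refine ⟨bil_1 r hr x hx, ?_⟩
    cases ad
    · exact tri_1_D r hr x hx
    · exact tri_1_AD r hr x hx
  · refine ⟨bil_2 r hr x hx, ?_⟩
    cases ad
    · exact tri_2_D r hr x hx
    · exact tri_2_AD r hr x hx
  · refine ⟨bil_3 r hr x hx, ?_⟩
    cases ad
    · exact tri_3_D r hr x hx
    · exact tri_3_AD r hr x hx

end KNGoodGMgc

end Summit.CriticalPhenomena.PercolationContinuityZ3.Theorems
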